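import Summits.Schanuel.Schanuel.Theorems.SoloInformedX193Service

/-!
# X193 kernel line, file F8: the pieces of an enemy sequence (layer B, data)

Solo seat `solo-Schanuel-informed`, X193 kernel programme (design note
`work/s213/X193-KERNEL-DESIGN.md`, Amendment A12; pen proof `work/s194/X193-pen.md` §1;
file F2 = `SoloInformedX193Service` (the abstract structure `SoloServiceData` and its seven
laws); layer A (files F1–F7e, `SoloInformedX193Laws`) proved
`SoloServiceData.false_of_laws`: no structure satisfies the seven laws in the X193 range).

Layer B instantiates the structure from a point `ξ : ℂ` and a sequence of integer
polynomials `R : ℕ → ℤ[X]` (the enemy: `R n` of degree `≤ n`, height `≤ exp (n^β)`, small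
at the points `k ξ`, `k ≤ n^σ`).  This file holds the DATA only:

* the PIECES `soloX_pieceSet`: the normalised irreducible integer polynomials of positive
  degree other than `X` (normalised in `ℤ[X]` = positive leading coefficient); the index
  type of the structure is the subtype `↥soloX_pieceSet`;
* the DILATION `soloX_dil P k j = j^g P(kT/j) = Σ a_i k^i j^(g-i) T^i` (`g = deg P`) and the
  TWIST POLYNOMIAL `soloX_twistPoly P k j = normalize (primPart (soloX_dil P k j))`;
* the structure `soloX_pieces ξ R : SoloServiceData soloX_pieceSet`: `deg` = `natDegree`,
  `logHt` = `log ‖P‖_∞` (Mathlib's `Polynomial.supNorm`, the norm `prop_3_1` is typed with),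
  `alive n` = the pieces among the normalised factors of `R n`, `mult P n` = the
  multiplicity of `P` in `normalizedFactors (R n)`, `bank P k = -log ‖P(kξ)‖`,
  `nearRoot P k` = "`P` has a complex root within `‖ξ‖/2` of `kξ`", and
  `twist P k j` = the twist polynomial when it is a piece (it always is for a piece `P`
  and `k, j ≥ 1` — proved in file F11a, not here), else `P` (harmless fallback);

together with the immediate API: accessors, the facts packed in piece membership, the
membership criterion for `alive` (`↔ P ∣ R n`), and the three local conjuncts of the law
`wellFormed` (`1 ≤ deg`, `0 ≤ logHt`, `alive ↔ 1 ≤ mult`).  No law is asserted here; the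
laws for `soloX_pieces ξ R` are files F9a–F11b, the assembly is F12.  No sorries.
-/

namespace Summit.Schanuel.Schanuel.Theorems

open Polynomial UniqueFactorizationMonoid

/-! ### The pieces -/

/-- The PIECES: normalised irreducible integer polynomials of positive degree, other than
`X` (the irreducible factors of positive degree of the enemy polynomials, `X` excluded since
`X ∣ R_n` is forced by smallness at the column `k = 0` and carries no information). -/
def soloX_pieceSet : Set ℤ[X] :=
  {P | Irreducible P ∧ normalize P = P ∧ 1 ≤ P.natDegree ∧ P ≠ X}

/-- Membership in the piece set, unfolded. -/
theorem soloX_mem_pieceSet_iff (P : ℤ[X]) :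
    P ∈ soloX_pieceSet ↔ Irreducible P ∧ normalize P = P ∧ 1 ≤ P.natDegree ∧ P ≠ X :=
  Iff.rfl

/-- A piece is irreducible. -/
theorem soloX_piece_irreducible (P : soloX_pieceSet) : Irreducible (P : ℤ[X]) := P.2.1

/-- A piece is normalised. -/
theorem soloX_piece_normalize (P : soloX_pieceSet) : normalize (P : ℤ[X]) = P := P.2.2.1

/-- A piece has positive degree. -/
theorem soloX_piece_natDegree_pos (P : soloX_pieceSet) : 1 ≤ (P : ℤ[X]).natDegree :=
  P.2.2.2.1

/-- A piece is not `X`. -/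
theorem soloX_piece_ne_X (P : soloX_pieceSet) : (P : ℤ[X]) ≠ X := P.2.2.2.2

/-- A piece is a non-zero polynomial. -/
theorem soloX_piece_ne_zero (P : soloX_pieceSet) : (P : ℤ[X]) ≠ 0 :=
  (soloX_piece_irreducible P).ne_zero

/-- A piece is primitive (irreducible of positive degree over a domain). -/
theorem soloX_piece_isPrimitive (P : soloX_pieceSet) : (P : ℤ[X]).IsPrimitive :=
  (soloX_piece_irreducible P).isPrimitive (by have := soloX_piece_natDegree_pos P; omega)

/-- The leading coefficient of a piece is a non-zero integer. -/
theorem soloX_piece_leadingCoeff_ne_zero (P : soloX_pieceSet) :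
    (P : ℤ[X]).leadingCoeff ≠ 0 :=
  leadingCoeff_ne_zero.mpr (soloX_piece_ne_zero P)

/-- The sup norm of a piece is at least `1` (its leading coefficient is a non-zero
integer). -/
theorem soloX_piece_one_le_supNorm (P : soloX_pieceSet) : 1 ≤ (P : ℤ[X]).supNorm := by
  have h1 : ‖(P : ℤ[X]).leadingCoeff‖ ≤ (P : ℤ[X]).supNorm := le_supNorm _ _
  have h2 : (1 : ℝ) ≤ ‖(P : ℤ[X]).leadingCoeff‖ := by
    rw [Int.norm_eq_abs]
    exact_mod_cast Int.one_le_abs (soloX_piece_leadingCoeff_ne_zero P)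
  exact h2.trans h1

/-- Two pieces with the same underlying polynomial are equal. -/
theorem soloX_piece_ext {P Q : soloX_pieceSet} (h : (P : ℤ[X]) = Q) : P = Q := Subtype.ext h

/-! ### Dilation and twist polynomials -/

/-- The DILATION of `P` carrying column `k` to column `j`:
`soloX_dil P k j = j^g · P(kT/j) = Σ_i a_i k^i j^(g-i) T^i` where `g = deg P`, realised as
`scaleRoots (P ∘ (kT)) j`.  Its value at `j z` is `j^g P(k z)`. -/
noncomputable def soloX_dil (P : ℤ[X]) (k j : ℕ) : ℤ[X] :=
  (P.comp (C (k : ℤ) * X)).scaleRoots (j : ℤ)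

/-- The TWIST POLYNOMIAL: the normalised primitive part of the dilation (the canonical
representative of the irreducible factor class of `j^g P(kT/j)`). -/
noncomputable def soloX_twistPoly (P : ℤ[X]) (k j : ℕ) : ℤ[X] :=
  normalize (soloX_dil P k j).primPart

/-- The dilation, unfolded. -/
theorem soloX_dil_def (P : ℤ[X]) (k j : ℕ) :
    soloX_dil P k j = (P.comp (C (k : ℤ) * X)).scaleRoots (j : ℤ) := rfl

/-- The twist polynomial, unfolded. -/
theorem soloX_twistPoly_def (P : ℤ[X]) (k j : ℕ) :
    soloX_twistPoly P k j = normalize (soloX_dil P k j).primPart := rfl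

/-- The coefficients of the dilation of `P ∘ (kT)`: `coeff_i = (P ∘ kT)_i · j^(deg - i)`. -/
theorem soloX_coeff_dil (P : ℤ[X]) (k j i : ℕ) :
    (soloX_dil P k j).coeff i =
      (P.comp (C (k : ℤ) * X)).coeff i *
        (j : ℤ) ^ ((P.comp (C (k : ℤ) * X)).natDegree - i) := by
  rw [soloX_dil_def, coeff_scaleRoots]

/-- The dilation has the degree of `P ∘ (kT)`. -/
theorem soloX_natDegree_dil (P : ℤ[X]) (k j : ℕ) :
    (soloX_dil P k j).natDegree = (P.comp (C (k : ℤ) * X)).natDegree := by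
  rw [soloX_dil_def, natDegree_scaleRoots]

/-- The twist polynomial is normalised. -/
theorem soloX_normalize_twistPoly (P : ℤ[X]) (k j : ℕ) :
    normalize (soloX_twistPoly P k j) = soloX_twistPoly P k j := by
  rw [soloX_twistPoly_def, normalize_idem]

/-! ### The concrete service structure -/

open scoped Classical in
/-- The SERVICE DATA of the pair `(ξ, R)`: pieces indexed by `soloX_pieceSet`; `deg` the
degree, `logHt = log ‖P‖_∞`, `alive n` the pieces among the normalised irreducible factors
of `R n` with multiplicities `mult P n`, `bank P k = -log ‖P(kξ)‖`, `nearRoot P k` iff some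
complex root of `P` lies within `‖ξ‖/2` of `kξ`, and `twist P k j` the twist polynomial of
`P` (carry column `k` to column `j`) whenever it is a piece, else `P` itself (fallback,
never met for a piece and `k, j ≥ 1`: file F11a). -/
noncomputable def soloX_pieces (ξ : ℂ) (R : ℕ → ℤ[X]) :
    SoloServiceData soloX_pieceSet where
  deg P := (P : ℤ[X]).natDegree
  logHt P := Real.log (P : ℤ[X]).supNorm
  alive n := (normalizedFactors (R n)).toFinset.subtype (· ∈ soloX_pieceSet)
  mult P n := (normalizedFactors (R n)).count (P : ℤ[X])
  bank P k := -Real.log ‖aeval ((k : ℂ) * ξ) (P : ℤ[X])‖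
  nearRoot P k :=
    decide (∃ α ∈ (P : ℤ[X]).aroots ℂ, ‖(k : ℂ) * ξ - α‖ < ‖ξ‖ / 2)
  twist P k j := if h : soloX_twistPoly (P : ℤ[X]) k j ∈ soloX_pieceSet then ⟨_, h⟩ else P

section accessors

variable (ξ : ℂ) (R : ℕ → ℤ[X])

/-- Accessor: the degree of a piece is its `natDegree`. -/
@[simp] theorem soloX_pieces_deg (P : soloX_pieceSet) :
    (soloX_pieces ξ R).deg P = (P : ℤ[X]).natDegree := rfl

/-- Accessor: the log-height of a piece is `log ‖P‖_∞`. -/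
@[simp] theorem soloX_pieces_logHt (P : soloX_pieceSet) :
    (soloX_pieces ξ R).logHt P = Real.log (P : ℤ[X]).supNorm := rfl

/-- Accessor: the multiplicity of `P` at level `n` is its count among the normalised
factors of `R n`. -/
theorem soloX_pieces_mult (P : soloX_pieceSet) (n : ℕ) :
    (soloX_pieces ξ R).mult P n = (normalizedFactors (R n)).count (P : ℤ[X]) := rfl

/-- Accessor: the bank of `P` at column `k` is `-log ‖P(kξ)‖`. -/
@[simp] theorem soloX_pieces_bank (P : soloX_pieceSet) (k : ℕ) :
    (soloX_pieces ξ R).bank P k = -Real.log ‖aeval ((k : ℂ) * ξ) (P : ℤ[X])‖ := rfl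

open scoped Classical in
/-- Membership in `alive n`: `P` is alive at level `n` iff it is one of the normalised
irreducible factors of `R n`. -/
theorem soloX_pieces_mem_alive_iff (P : soloX_pieceSet) (n : ℕ) :
    P ∈ (soloX_pieces ξ R).alive n ↔ (P : ℤ[X]) ∈ normalizedFactors (R n) := by
  show P ∈ (normalizedFactors (R n)).toFinset.subtype (· ∈ soloX_pieceSet) ↔ _
  rw [Finset.mem_subtype, Multiset.mem_toFinset]

/-- Membership in `alive n` for `R n ≠ 0`: `P` is alive at level `n` iff `P ∣ R n`. -/
theorem soloX_pieces_mem_alive_iff_dvd (P : soloX_pieceSet) {n : ℕ} (hR : R n ≠ 0) :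
    P ∈ (soloX_pieces ξ R).alive n ↔ (P : ℤ[X]) ∣ R n := by
  rw [soloX_pieces_mem_alive_iff, mem_normalizedFactors_iff' hR]
  exact ⟨fun h => h.2.2,
    fun h => ⟨soloX_piece_irreducible P, soloX_piece_normalize P, h⟩⟩

/-- Nothing is alive at a level where `R n = 0` (the normalised factors of `0` are `∅`). -/
theorem soloX_pieces_not_mem_alive_of_eq_zero (P : soloX_pieceSet) {n : ℕ} (hR : R n = 0) :
    P ∉ (soloX_pieces ξ R).alive n := by
  rw [soloX_pieces_mem_alive_iff, hR, normalizedFactors_zero]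
  exact Multiset.notMem_zero _

open scoped Classical in
/-- The near-root relation, unfolded: `nearRoot P k = true` iff some complex root of `P`
lies within `‖ξ‖/2` of `kξ`. -/
theorem soloX_pieces_nearRoot_iff (P : soloX_pieceSet) (k : ℕ) :
    (soloX_pieces ξ R).nearRoot P k = true ↔
      ∃ α ∈ (P : ℤ[X]).aroots ℂ, ‖(k : ℂ) * ξ - α‖ < ‖ξ‖ / 2 := by
  show decide _ = true ↔ _
  rw [decide_eq_true_iff]

/-- The near-root relation fails iff every complex root of `P` is at distance `≥ ‖ξ‖/2`
from `kξ`. -/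
theorem soloX_pieces_nearRoot_eq_false_iff (P : soloX_pieceSet) (k : ℕ) :
    (soloX_pieces ξ R).nearRoot P k = false ↔
      ∀ α ∈ (P : ℤ[X]).aroots ℂ, ‖ξ‖ / 2 ≤ ‖(k : ℂ) * ξ - α‖ := by
  rw [← Bool.not_eq_true, soloX_pieces_nearRoot_iff]
  simp only [not_exists, not_and, not_lt]

open scoped Classical in
/-- The twist of a piece, when the twist polynomial is a piece: its underlying polynomial
is the twist polynomial. -/
theorem soloX_pieces_twist_val (P : soloX_pieceSet) (k j : ℕ)
    (h : soloX_twistPoly (P : ℤ[X]) k j ∈ soloX_pieceSet) :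
    ((soloX_pieces ξ R).twist P k j : ℤ[X]) = soloX_twistPoly (P : ℤ[X]) k j := by
  show ((if h : soloX_twistPoly (P : ℤ[X]) k j ∈ soloX_pieceSet then ⟨_, h⟩ else P :
    soloX_pieceSet) : ℤ[X]) = _
  rw [dif_pos h]

open scoped Classical in
/-- The twist of a piece, fallback clause: when the twist polynomial is not a piece the
twist is `P` itself. -/
theorem soloX_pieces_twist_of_not_mem (P : soloX_pieceSet) (k j : ℕ)
    (h : soloX_twistPoly (P : ℤ[X]) k j ∉ soloX_pieceSet) :
    (soloX_pieces ξ R).twist P k j = P := by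
  show ((if h : soloX_twistPoly (P : ℤ[X]) k j ∈ soloX_pieceSet then ⟨_, h⟩ else P :
    soloX_pieceSet)) = _
  rw [dif_neg h]

end accessors

/-! ### The local conjuncts of `wellFormed` -/

section wellFormedLocal

variable (ξ : ℂ) (R : ℕ → ℤ[X])

/-- (WF, first conjunct) every piece has degree `≥ 1`. -/
theorem soloX_pieces_one_le_deg (P : soloX_pieceSet) : 1 ≤ (soloX_pieces ξ R).deg P :=
  soloX_piece_natDegree_pos P

/-- (WF, second conjunct) every piece has log-height `≥ 0` (`‖P‖_∞ ≥ 1`). -/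
theorem soloX_pieces_logHt_nonneg (P : soloX_pieceSet) : 0 ≤ (soloX_pieces ξ R).logHt P :=
  Real.log_nonneg (soloX_piece_one_le_supNorm P)

/-- (WF, third conjunct) a piece is alive at level `n` iff its multiplicity there is
`≥ 1`. -/
theorem soloX_pieces_alive_iff_mult (P : soloX_pieceSet) (n : ℕ) :
    P ∈ (soloX_pieces ξ R).alive n ↔ 1 ≤ (soloX_pieces ξ R).mult P n := by
  rw [soloX_pieces_mem_alive_iff, soloX_pieces_mult, Multiset.one_le_count_iff_mem]

/-- The multiplicity of a piece that is not alive is `0`. -/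
theorem soloX_pieces_mult_eq_zero (P : soloX_pieceSet) {n : ℕ}
    (h : P ∉ (soloX_pieces ξ R).alive n) : (soloX_pieces ξ R).mult P n = 0 := by
  rw [soloX_pieces_alive_iff_mult] at h
  omega

/-- The three local conjuncts of `wellFormed` hold for `soloX_pieces ξ R` (the remaining
two, on near-root columns, are file F9a). -/
theorem soloX_pieces_wellFormed_local :
    (∀ P, 1 ≤ (soloX_pieces ξ R).deg P) ∧ (∀ P, 0 ≤ (soloX_pieces ξ R).logHt P) ∧
      (∀ P n, P ∈ (soloX_pieces ξ R).alive n ↔ 1 ≤ (soloX_pieces ξ R).mult P n) :=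
  ⟨soloX_pieces_one_le_deg ξ R, soloX_pieces_logHt_nonneg ξ R,
    soloX_pieces_alive_iff_mult ξ R⟩

end wellFormedLocal

end Summit.Schanuel.Schanuel.Theorems
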